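import Mathlib
import Literature.NumberTheory.GaloisRepresentations.ToLocalRestrictField
import HarnessLib

/-!
# CrystallineBaseChange

Topic `Literature/NumberTheory/PAdicHodge`. Named literature fact(s) relocated by the gate from `Summits/Langlands/Langlands/Theorems/StickelbergerDialUnramifiedFermatWitnessPinCoherence.lean`
(accept-time relocation of `[cite]`d propositions written inline in a Summits proposal; human ruling 2026-08-15).
Sources: BrinonConrad2009, FontaineAsterisque223III, FontaineAsterisque223VIII.

* `Literature.NumberTheory.PAdicHodge.CrystallineBaseChange`
* `Literature.NumberTheory.PAdicHodge.LabelledHodgeTateWeightsBaseChange`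
-/

namespace Literature.NumberTheory.PAdicHodge

/-- **Crystallinity for THE pinned Fontaine data is insensitive to a finite extension of the `ℓ`-adic base
field** (Fontaine 1994, Exp. VIII §2.3.7 with Exp. III §5.1: a de Rham representation is crystalline iff its
`D_pst` has trivial inertia action and `N = 0`, a condition visibly stable under restriction to `Γ_L` for `L/K`
finite; equivalently: `B_cris ⊆ B_dR` is built from `𝒪_{C_K}` with its Galois action alone, so it is the same ring for a
finite `L/K` and `B_cris`-admissibility of `V` as a `G_K`-representation restricts to `G_L`, Brinon–Conrad 2009 §9.1 and
the discussion before Prop. 6.3.8), tree form for THE pinned data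
`fontainePst` (NAMED FACT, D-0014): for a continuous embedding `K → L` of characteristic-`0` non-archimedean local
fields of residue characteristic `ℓ` (`hK : |ℓ|_K < 1`, `hL : |ℓ|_L < 1`) and a framed `ρ : Γ_K →ₜ* GL_n(ℚ̄_ℓ)`
crystalline for `fontainePst K ℓ hK` (`IsCrystallineFramed`: de Rham and the attached Weil–Deligne representation
unramified with `N = 0`), the restriction `ρ ∘ absGaloisRestrict K L` is crystalline for `fontainePst L ℓ hL`.
Sibling of the accepted `Literature.NumberTheory.PAdicHodge.DeRhamBaseChange` (same binders).  Discharging it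
requires the Weil–Deligne half of `fontainePst` to be the CONSTRUCTION `WD ∘ D_pst` (definition item
`defn-FontainePstWeilDeligneData`, D2): today that half is chosen by Hilbert's ε independently at `K` and at `L`
and is specified only for locally unramified representations (clause (F8) of `IsFontaineDatum`), so the statement
is consumed as a hypothesis (crux `StickelbergerDial.UnramifiedFermatWitness`, line `Sketch`, stub S3a, whose
registered signature is this statement verbatim).
-- TODO(general form): `B_cris`-admissibility for every complete discretely-valued `K'/K ⊆ C_K`, and the converse.
[cite: FontaineAsterisque223VIII, §2.3.7] [cite: FontaineAsterisque223III, Exp. III §5.1]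
[cite: BrinonConrad2009, §9.1 and Prop. 6.3.8] [file NumberTheory/PAdicHodge/CrystallineBaseChange] -/
def CrystallineBaseChange : Prop :=
    ∀ (ℓ : ℕ) [Fact ℓ.Prime] (K L : Type) [Field K] [ValuativeRel K] [TopologicalSpace K]
      [IsNonarchimedeanLocalField K] [CharZero K] [Field L] [ValuativeRel L] [TopologicalSpace L]
      [IsNonarchimedeanLocalField L] [CharZero L] [Algebra K L], Continuous (algebraMap K L) →
      ∀ (hK : ValuativeRel.valuation K (ℓ : K) < 1) (hL : ValuativeRel.valuation L (ℓ : L) < 1) (n : ℕ)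
        (ρ : Literature.NumberTheory.GaloisRepresentations.FramedRep (Field.absoluteGaloisGroup K) (PadicAlgCl ℓ) n),
        (Literature.NumberTheory.PAdicHodge.fontainePst K ℓ hK).IsCrystallineFramed ρ →
          (Literature.NumberTheory.PAdicHodge.fontainePst L ℓ hL).IsCrystallineFramed
            (ρ.comp (Literature.NumberTheory.GaloisRepresentations.absGaloisRestrict K L))

/-- **The labelled Hodge–Tate weights for THE pinned Fontaine data are insensitive to a finite extension of the
`ℓ`-adic base field** (Brinon–Conrad 2009, Prop. 6.3.8: "the natural map `K' ⊗_K D_{dR,K}(V) → D_{dR,K'}(V)` is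
an isomorphism in `Fil_{K'}`", whence `gr^i` commutes with the finite base change and, label by label,
`HT_{τ''}(V|_{Γ_L}) = HT_{τ''|_K}(V)` for every `ℚ_ℓ`-embedding `τ'' : L → ℚ̄_ℓ`; Fontaine 1994, Exp. III §1.5,
§3), tree form for THE pinned data (NAMED FACT, D-0014): for a continuous embedding `K → L` of characteristic-`0`
non-archimedean local fields of residue characteristic `ℓ`, a framed `ρ : Γ_K →ₜ* GL_n(ℚ̄_ℓ)` and `S : Multiset ℤ`,
if every `τ'`-labelled Hodge–Tate multiset of `ρ` relative to `(fontainePst K ℓ hK).𝔅 = B_dR(K)` (labels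
`τ' : K →ₐ[ℚ_ℓ] ℚ̄_ℓ` for the datum's `ℚ_ℓ`-structure, written with explicit instances) equals `S`, then every
`τ''`-labelled multiset of `ρ ∘ absGaloisRestrict K L` relative to `B_dR(L)` equals `S`.  The period rings ARE the
constructions `bdRPeriodRingData` (clause (F9) of `FontaineDpst`, unconditionally), so discharging this is the
transport of the tree's `B_dR(L)` to `B_dR(K)` along `\widehat{K̄} ≅ \widehat{L̄}` followed by Prop. 6.3.8 — the
same not-yet-formalised functoriality recorded on `DeRhamBaseChange`.  Consumed as a hypothesis by crux
`StickelbergerDial.UnramifiedFermatWitness`, line `Sketch`, stub S3b (registered signature = this statement).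
-- TODO(general form): the filtered isomorphism `K' ⊗_K D_{dR,K}(V) ≅ D_{dR,K'}(V)` itself, for every complete discretely-valued `K'/K ⊆ C_K`.
[cite: BrinonConrad2009, Prop. 6.3.8] [cite: FontaineAsterisque223III, Exp. III §1.5 and §3]
[file NumberTheory/PAdicHodge/CrystallineBaseChange] -/
def LabelledHodgeTateWeightsBaseChange : Prop :=
    ∀ (ℓ : ℕ) [Fact ℓ.Prime] (K L : Type) [Field K] [ValuativeRel K] [TopologicalSpace K]
      [IsNonarchimedeanLocalField K] [CharZero K] [Field L] [ValuativeRel L] [TopologicalSpace L]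
      [IsNonarchimedeanLocalField L] [CharZero L] [Algebra K L], Continuous (algebraMap K L) →
      ∀ (hK : ValuativeRel.valuation K (ℓ : K) < 1) (hL : ValuativeRel.valuation L (ℓ : L) < 1) (n : ℕ)
        (ρ : Literature.NumberTheory.GaloisRepresentations.FramedRep (Field.absoluteGaloisGroup K) (PadicAlgCl ℓ) n) (S : Multiset ℤ),
        (∀ τ' : @AlgHom ℚ_[ℓ] K (PadicAlgCl ℓ) _ _ _ (Literature.NumberTheory.PAdicHodge.fontainePst K ℓ hK).algebra _,
          @Literature.NumberTheory.GaloisRepresentations.PeriodRingData.labelledHodgeTateWeights _ _ _ ℚ_[ℓ] K _ _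
            (Literature.NumberTheory.PAdicHodge.fontainePst K ℓ hK).algebra (PadicAlgCl ℓ) _ _ _ _ _ _ _ _ _
            (Literature.NumberTheory.PAdicHodge.fontainePst K ℓ hK).𝔅 (Literature.NumberTheory.GaloisRepresentations.FramedRep.toContinuousRep ρ)
            (@AlgHom.toRingHom ℚ_[ℓ] K (PadicAlgCl ℓ) _ _ _ (Literature.NumberTheory.PAdicHodge.fontainePst K ℓ hK).algebra _ τ') = S) →
        ∀ τ'' : @AlgHom ℚ_[ℓ] L (PadicAlgCl ℓ) _ _ _ (Literature.NumberTheory.PAdicHodge.fontainePst L ℓ hL).algebra _,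
          @Literature.NumberTheory.GaloisRepresentations.PeriodRingData.labelledHodgeTateWeights _ _ _ ℚ_[ℓ] L _ _
            (Literature.NumberTheory.PAdicHodge.fontainePst L ℓ hL).algebra (PadicAlgCl ℓ) _ _ _ _ _ _ _ _ _
            (Literature.NumberTheory.PAdicHodge.fontainePst L ℓ hL).𝔅 (Literature.NumberTheory.GaloisRepresentations.FramedRep.toContinuousRep (ρ.comp (Literature.NumberTheory.GaloisRepresentations.absGaloisRestrict K L)))
            (@AlgHom.toRingHom ℚ_[ℓ] L (PadicAlgCl ℓ) _ _ _ (Literature.NumberTheory.PAdicHodge.fontainePst L ℓ hL).algebra _ τ'') = S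

end Literature.NumberTheory.PAdicHodge
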